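import Mathlib
import Summits.ResolutionOfSingularities.ResolutionOfSingularities.Theorems.RadicialJungCleanModelsCleanPatchingDefs
import Summits.ResolutionOfSingularities.ResolutionOfSingularities.Theorems.RadicialJungCleanModelsCleanPointBlowupChart
import Literature.AlgebraicGeometry.Resolution.RsopMonomialIdeals
import HarnessLib

/-!
# Route `RadicialJung`, crux `CleanModels` (stmt-15917), stub `stub_cleanLU3`: **cleanness from a best `p`-th-power
# approximation** (the defectless half of clean local uniformization — read-off lemma)

Line `Sketch` rev 16 of crux stmt-ResolutionOfSingularities-15917, memo `Cruxes/CleanModels/Lines/Sketch-memo-open-stubs.md`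
§2.  OURS; nothing here proves resolution in characteristic `p`.

Setting: `K` a field of characteristic `p`, `O ⊆ K` a valuation ring, `R ⊆ O` a regular local subring DOMINATED by `O`
(`𝔪_R ⊆ 𝔪_O`), `g₀ ∈ K`.  If `f₀ ∈ K` is a **best `p`-th-power approximation** of `g₀` for the valuation `v` of `O` — `v (g₀ - f₀^p)`
is MINIMAL among the `v (g₀ - f^p)`, `f ∈ K` (multiplicative convention: minimal value = most divisible) — and the remainder
`g₀ - f₀^p` is a unit times a monomial in a regular system of parameters of `R` (the output of embedded resolution at the centre),
then `g₀` is `CleanRegAt` at `R`: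
* some exponent prime to `p` ⟹ discard the `p`-th powers (twist the representative by `h⁻¹`, `h = ∏ tᵢ^{⌊aᵢ/p⌋}`) ⟹ form (1)
  in the sub-family of parameters with exponents `aᵢ mod p ≠ 0` (`looseCleanForm_one_of_isRsopPart`);
* all exponents divisible by `p` ⟹ the twisted representative is the unit `u`; either `u - c^p ∉ 𝔪` for all `c` (form (2)), or
  `u - c^p ∈ 𝔪 \ 𝔪²` (form (3)), or `u - c^p ∈ 𝔪²` for some `c ∈ R` — and then `f₀ + c h` is a STRICTLY better approximation
  (`g₀ - (f₀ + ch)^p = h^p (u - c^p)`, `v (u - c^p) < 1 = v u`), contradicting minimality.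

Main result: `cleanRegAt_of_isMin_pthPowerApprox`.  A best approximation exists whenever the extension `K(g₀^{1/p}) / K` is
defectless at `v` (ramification index or residue degree `p`); the defect case is the research residue of `stub_cleanLU3`.
-/

noncomputable section

set_option linter.dupNamespace false -- mandated namespace of this single-conjunct summit

open IsLocalRing
open Literature.AlgebraicGeometry.Resolution

namespace Summit.ResolutionOfSingularities.ResolutionOfSingularities.Theorems.RadicialJung.CleanModels

variable {p : ℕ} [hp : Fact p.Prime] {K : Type} [Field K] [CharP K p]

/-- The two-term representative `h⁻ᵖ (g₀ - f₀^p) = (h⁻¹)^p g₀ + (-(f₀ h⁻¹))^p` lies in `K^p(g₀)` with a nonzero coefficient in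
positive degree. [folklore] -/
theorem exists_rep_sub_pow_div (g₀ f₀ h : K) (hh : h ≠ 0) :
    ∃ c : Fin p → K, (∃ j : Fin p, (j : ℕ) ≠ 0 ∧ c j ≠ 0) ∧
      (∑ j : Fin p, c j ^ p * g₀ ^ (j : ℕ)) = (h⁻¹) ^ p * (g₀ - f₀ ^ p) := by
  have hp1 : 1 < p := hp.out.one_lt
  let j₀ : Fin p := ⟨0, hp.out.pos⟩
  let j₁ : Fin p := ⟨1, hp1⟩
  have hne : j₀ ≠ j₁ := by
    intro h0; have := congrArg Fin.val h0; simp [j₀, j₁] at this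
  let c : Fin p → K := fun j => if j = j₁ then h⁻¹ else if j = j₀ then -(f₀ * h⁻¹) else 0
  refine ⟨c, ⟨j₁, by simp [j₁], by simp [c, hh]⟩, ?_⟩
  rw [Fintype.sum_eq_add j₀ j₁ hne]
  · have hc0 : c j₀ = -(f₀ * h⁻¹) := by simp [c, hne]
    have hc1 : c j₁ = h⁻¹ := by simp [c]
    rw [hc0, hc1]
    simp only [j₀, j₁, pow_zero, mul_one, pow_one]
    rw [neg_pow, mul_pow, neg_one_pow_char K p]
    ring
  · intro j hj
    have : c j = 0 := by simp [c, hj.1, hj.2]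
    rw [this, zero_pow hp.out.ne_zero, zero_mul]

/-- **Cleanness from a best `p`-th-power approximation whose remainder is a unit times a monomial in a regular system of
parameters** (memo `Sketch-memo-open-stubs.md` §2; the read-off step of clean local uniformization at defectless valuations).
[folklore] -/
theorem cleanRegAt_of_isMin_pthPowerApprox (O : ValuationSubring K) (R : Subring K) [IsRegularLocalRing R]
    (hRO : R ≤ O.toSubring) (hdom : ∀ x : R, x ∈ maximalIdeal R → O.valuation (x : K) < 1)
    (g₀ f₀ : K) (hmin : ∀ f : K, O.valuation (g₀ - f₀ ^ p) ≤ O.valuation (g₀ - f ^ p))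
    {d : ℕ} (t : Fin d → R) (ht : Ideal.span (Set.range t) = maximalIdeal R) (hd : ringKrullDim R = d)
    (a : Fin d → ℕ) (u : R) (hu : IsUnit u) (hG : g₀ - f₀ ^ p = (u : K) * ∏ i, (t i : K) ^ a i) :
    CleanRegAt p R.subtype g₀ := by
  classical
  -- `t` is a regular system of parameters; its members are nonzero
  have hd' : (maximalIdeal R).spanFinrank = d := by
    have h := IsRegularLocalRing.spanFinrank_maximalIdeal (R := R)
    rw [hd] at h
    exact_mod_cast h
  have htrsop : IsRsopPart t := isRsopPart_comp_of_rsop hd' t ht id Function.injective_id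
  have ht0 : ∀ i, (t i : K) ≠ 0 := fun i h0 => htrsop.ne_zero i (Subtype.ext h0)
  -- the `p`-th power part `h` and the reduced exponents `b`
  let h : R := ∏ i, t i ^ (a i / p)
  let b : Fin d → ℕ := fun i => a i % p
  have hcoe : (h : K) = ∏ i, (t i : K) ^ (a i / p) := by
    simp only [h]; push_cast; rfl
  have hh0 : (h : K) ≠ 0 := by
    rw [hcoe]
    exact Finset.prod_ne_zero_iff.mpr fun i _ => pow_ne_zero _ (ht0 i)
  have hsplit : (∏ i, (t i : K) ^ a i) = (h : K) ^ p * ∏ i, (t i : K) ^ b i := by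
    rw [hcoe, ← Finset.prod_pow, ← Finset.prod_mul_distrib]
    refine Finset.prod_congr rfl fun i _ => ?_
    rw [← pow_mul, ← pow_add]
    congr 1
    rw [mul_comm]
    exact (Nat.div_add_mod (a i) p).symm
  -- the twisted representative `G = h⁻ᵖ (g₀ - f₀^p) = u ∏ tᵢ^{bᵢ}`
  obtain ⟨c, hc, hsum⟩ := exists_rep_sub_pow_div g₀ f₀ (h : K) hh0
  have hGc : (∑ j : Fin p, c j ^ p * g₀ ^ (j : ℕ)) = (u : K) * ∏ i, (t i : K) ^ b i := by
    have h1 : (h : K)⁻¹ ^ p * (h : K) ^ p = 1 := by rw [← mul_pow, inv_mul_cancel₀ hh0, one_pow]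
    rw [hsum, hG, hsplit]
    calc (h : K)⁻¹ ^ p * ((u : K) * ((h : K) ^ p * ∏ i, (t i : K) ^ b i))
        = ((h : K)⁻¹ ^ p * (h : K) ^ p) * ((u : K) * ∏ i, (t i : K) ^ b i) := by ring
      _ = (u : K) * ∏ i, (t i : K) ^ b i := by rw [h1, one_mul]
  refine ⟨‹_›, c, hc, ?_⟩
  -- the set of exponents prime to `p`
  let I : Finset (Fin d) := Finset.univ.filter fun i => ¬ p ∣ a i
  by_cases hI : I.Nonempty
  · -- form (1) in the sub-family indexed by `I`
    have hn : 0 < I.card := Finset.card_pos.mpr hI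
    let e : Fin I.card ≃ ↥I := I.equivFin.symm
    let ι : Fin I.card → Fin d := fun j => (e j).1
    have hιmem : ∀ j, ι j ∈ I := fun j => (e j).2
    have hιinj : Function.Injective ι := fun j j' hjj' => e.injective (Subtype.ext hjj')
    have hz : IsRsopPart (t ∘ ι) := isRsopPart_comp_of_rsop hd' t ht ι hιinj
    have hb' : ∀ j, ¬ p ∣ b (ι j) := by
      intro j hdvd
      have hmemI := (Finset.mem_filter.mp (hιmem j)).2
      have hlt : b (ι j) < p := Nat.mod_lt _ hp.out.pos
      have hb0 : b (ι j) = 0 := Nat.eq_zero_of_dvd_of_lt hdvd hlt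
      exact hmemI (Nat.dvd_of_mod_eq_zero hb0)
    -- `∏_{i} tᵢ^{bᵢ} = ∏_{j} t(ι j)^{b (ι j)}`: the factors off `I` are `1`
    have hoff : ∀ i, i ∉ I → (t i : K) ^ b i = 1 := by
      intro i hi
      have : p ∣ a i := by
        by_contra hcon
        exact hi (Finset.mem_filter.mpr ⟨Finset.mem_univ _, hcon⟩)
      simp [b, Nat.dvd_iff_mod_eq_zero.mp this]
    have hprodI : (∏ i, (t i : K) ^ b i) = ∏ j : Fin I.card, (t (ι j) : K) ^ b (ι j) := by
      rw [← Finset.prod_subset (Finset.subset_univ I) (fun i _ hi => hoff i hi), ← Finset.prod_coe_sort]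
      exact (Fintype.prod_equiv e (fun j => (t (ι j) : K) ^ b (ι j)) (fun i => (t i.1 : K) ^ b i.1)
        (fun j => rfl)).symm
    refine looseCleanForm_one_of_isRsopPart p R.subtype hz hn (fun j => b (ι j)) hb' hu (Y := _) ?_
    rw [hGc, map_mul, map_prod, hprodI]
    simp only [Function.comp_apply, map_pow, Subring.coe_subtype]
  · -- all exponents divisible by `p`: the representative is the unit `u`
    have hall : ∀ i, (t i : K) ^ b i = 1 := by
      intro i
      have : p ∣ a i := by
        by_contra hcon
        exact hI ⟨i, Finset.mem_filter.mpr ⟨Finset.mem_univ _, hcon⟩⟩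
      simp [b, Nat.dvd_iff_mod_eq_zero.mp this]
    have hGu : (∑ j : Fin p, c j ^ p * g₀ ^ (j : ℕ)) = R.subtype u := by
      rw [hGc, Finset.prod_eq_one fun i _ => hall i, mul_one]; rfl
    by_cases h2 : ∀ c' : R, u - c' ^ p ∉ maximalIdeal R
    · exact Or.inr (Or.inl ⟨u, hu, hGu, h2⟩)
    · push Not at h2
      obtain ⟨c', hc'⟩ := h2
      by_cases h3 : u - c' ^ p ∈ maximalIdeal R ^ 2
      · -- a strictly better approximation: contradiction
        exfalso
        have hprod1 : (∏ i, (t i : K) ^ a i) = (h : K) ^ p := by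
          rw [hsplit, Finset.prod_eq_one fun i _ => hall i, mul_one]
        have hbetter : g₀ - (f₀ + (c' : K) * h) ^ p = (h : K) ^ p * ((u : K) - (c' : K) ^ p) := by
          rw [add_pow_char f₀ ((c' : K) * h) p, ← sub_sub, hG, hprod1, mul_pow]
          ring
        have hvu : O.valuation (u : K) = 1 := by
          obtain ⟨w, hw⟩ := hu
          have h1 : O.valuation ((w : R) : K) * O.valuation ((↑(w⁻¹ : Rˣ) : R) : K) = 1 := by
            rw [← map_mul, ← Subring.coe_mul, ← Units.val_mul, mul_inv_cancel, Units.val_one, Subring.coe_one, map_one]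
          have hle1 : O.valuation ((w : R) : K) ≤ 1 := (O.valuation_le_one_iff _).mpr (hRO (w : R).2)
          have hle2 : O.valuation ((↑(w⁻¹ : Rˣ) : R) : K) ≤ 1 := (O.valuation_le_one_iff _).mpr (hRO (↑(w⁻¹ : Rˣ) : R).2)
          rw [← hw]
          exact le_antisymm hle1 (by
            calc (1 : _) = O.valuation ((w : R) : K) * O.valuation ((↑(w⁻¹ : Rˣ) : R) : K) := h1.symm
              _ ≤ O.valuation ((w : R) : K) * 1 := mul_le_mul_right hle2 _
              _ = O.valuation ((w : R) : K) := mul_one _)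
        have hlt : O.valuation ((u : K) - (c' : K) ^ p) < 1 := by
          have hmem : u - c' ^ p ∈ maximalIdeal R := Ideal.pow_le_self two_ne_zero h3
          have := hdom _ hmem
          simpa using this
        have hhp : O.valuation ((h : K) ^ p) ≠ 0 := by
          rw [map_pow]; exact pow_ne_zero _ ((Valuation.ne_zero_iff _).mpr hh0)
        have key : O.valuation (g₀ - (f₀ + (c' : K) * h) ^ p) < O.valuation (g₀ - f₀ ^ p) := by
          rw [hbetter, hG, hprod1, map_mul, map_mul, hvu, one_mul, mul_comm]
          calc O.valuation ((u : K) - (c' : K) ^ p) * O.valuation ((h : K) ^ p)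
              < 1 * O.valuation ((h : K) ^ p) := mul_lt_mul_of_pos_right hlt (zero_lt_iff.mpr hhp)
            _ = O.valuation ((h : K) ^ p) := one_mul _
        exact absurd (hmin (f₀ + (c' : K) * h)) (not_le.mpr key)
      · exact Or.inr (Or.inr ⟨u, c', hGu, hc', h3⟩)

/-- The same read-off in the vocabulary of `stub_cleanLU3`: at the local ring `locAtCentre T O` of the centre of `O` on a
subring `T ⊆ O` (dominated by `O` by construction, `mem_maximalIdeal_locAtCentre_iff`). [folklore] -/
theorem cleanRegAt_locAtCentre_of_isMin_pthPowerApprox (O : ValuationSubring K) (T : Subring K)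
    (hTO : T ≤ O.toSubring) [IsRegularLocalRing (locAtCentre T O)] (g₀ f₀ : K)
    (hmin : ∀ f : K, O.valuation (g₀ - f₀ ^ p) ≤ O.valuation (g₀ - f ^ p))
    {d : ℕ} (t : Fin d → locAtCentre T O) (ht : Ideal.span (Set.range t) = maximalIdeal (locAtCentre T O))
    (hd : ringKrullDim (locAtCentre T O) = d) (a : Fin d → ℕ) (u : locAtCentre T O) (hu : IsUnit u)
    (hG : g₀ - f₀ ^ p = (u : K) * ∏ i, (t i : K) ^ a i) :
    CleanRegAt p (locAtCentre T O).subtype g₀ :=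
  cleanRegAt_of_isMin_pthPowerApprox O (locAtCentre T O) (locAtCentre_le hTO)
    (fun x hx => (mem_maximalIdeal_locAtCentre_iff hTO x).mp hx) g₀ f₀ hmin t ht hd a u hu hG

/-! ## Two elementary sources of best `p`-th-power approximations (the defectless situations) -/

/-- **Ramified witness.** If the value of `g₀ - f₁^p` is not the value of a `p`-th power, then `f₁` is a best `p`-th-power
approximation of `g₀`: `g₀ - f^p = (g₀ - f₁^p) + (f₁ - f)^p` has two summands of DIFFERENT values, so the ultrametric
inequality is an equality. [folklore] -/
theorem isMin_pthPowerApprox_of_valuation_ne_pow (O : ValuationSubring K) (g₀ f₁ : K)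
    (hne : ∀ x : K, O.valuation (g₀ - f₁ ^ p) ≠ O.valuation x ^ p) (f : K) :
    O.valuation (g₀ - f₁ ^ p) ≤ O.valuation (g₀ - f ^ p) := by
  have hsplit : g₀ - f ^ p = (g₀ - f₁ ^ p) + (f₁ - f) ^ p := by
    rw [sub_pow_char_of_commute (p := p) (Commute.all f₁ f)]; ring
  have hne' : O.valuation (g₀ - f₁ ^ p) ≠ O.valuation ((f₁ - f) ^ p) := by
    rw [map_pow]; exact hne _
  rw [hsplit, Valuation.map_add_of_distinct_val _ hne']
  exact le_max_left _ _

/-- **Inert witness.** If `g₀ - f₁^p = x^p · w` with `x ≠ 0` and `w` a unit of `O` whose residue is not a `p`-th power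
(`w - c^p ∉ 𝔪_O` for all `c ∈ O`), then `f₁` is a best `p`-th-power approximation of `g₀`. [folklore] -/
theorem isMin_pthPowerApprox_of_residue_not_pow (O : ValuationSubring K) (g₀ f₁ x : K) (hx : x ≠ 0) (w : O)
    (hw : ∀ c : O, O.valuation ((w : K) - (c : K) ^ p) = 1) (hG : g₀ - f₁ ^ p = x ^ p * (w : K)) (f : K) :
    O.valuation (g₀ - f₁ ^ p) ≤ O.valuation (g₀ - f ^ p) := by
  have hw1 : O.valuation (w : K) = 1 := by
    have := hw 0
    rwa [ZeroMemClass.coe_zero, zero_pow hp.out.ne_zero, sub_zero] at this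
  -- `g₀ - f^p = x^p (w - y^p)`, `y = (f - f₁)/x`
  set y : K := (f - f₁) / x with hy
  have hsplit : g₀ - f ^ p = x ^ p * ((w : K) - y ^ p) := by
    have : f = f₁ + x * y := by rw [hy, mul_div_cancel₀ _ hx]; ring
    rw [this, add_pow_char f₁ (x * y) p, ← sub_sub, hG, mul_pow]; ring
  rw [hG, hsplit, map_mul, map_mul, hw1, mul_one]
  have hxp : O.valuation (x ^ p) ≠ 0 := by rw [map_pow]; exact pow_ne_zero _ ((Valuation.ne_zero_iff _).mpr hx)
  by_cases hyO : y ∈ O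
  · rw [hw ⟨y, hyO⟩]; simp
  · -- `v y > 1`, so `v (w - y^p) = v (y^p) > 1`
    have hvy : 1 < O.valuation y := by
      rw [← not_le]; exact fun hle => hyO ((O.valuation_le_one_iff y).mp hle)
    have hvyp : 1 < O.valuation (y ^ p) := by
      rw [map_pow]; exact one_lt_pow₀ hvy hp.out.ne_zero
    have hne : O.valuation (w : K) ≠ O.valuation (-(y ^ p)) := by
      rw [Valuation.map_neg, hw1]; exact ne_of_lt hvyp
    have hval : O.valuation ((w : K) - y ^ p) = O.valuation (y ^ p) := by
      rw [sub_eq_add_neg, Valuation.map_add_of_distinct_val _ hne, Valuation.map_neg, hw1]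
      exact max_eq_right (le_of_lt hvyp)
    rw [hval]
    calc O.valuation (x ^ p) = O.valuation (x ^ p) * 1 := (mul_one _).symm
      _ ≤ O.valuation (x ^ p) * O.valuation (y ^ p) := mul_le_mul_right (le_of_lt hvyp) _

end Summit.ResolutionOfSingularities.ResolutionOfSingularities.Theorems.RadicialJung.CleanModels

end
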